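import Mathlib
import Summits.KontsevichZagierPeriods.KontsevichZagierPeriods.Theses.GammaCornerAnomaly
import Literature.NumberTheory.Transcendental.KZCalculus
import Literature.NumberTheory.Transcendental.KZLogCalculusProofs
import Literature.NumberTheory.Transcendental.KZBallPeelingAux
import Summits.KontsevichZagierPeriods.KontsevichZagierPeriods.Theorems.InverseLandauTateLiftingPullback
import Summits.KontsevichZagierPeriods.KontsevichZagierPeriods.Theorems.HeckeMultiplicityOneTorsionTiling11a1

/-!
# `LegendreCornerStrata` (stmt-KontsevichZagierPeriods-8980, route GammaCornerAnomaly) — proof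

The two strata of the blown-up Legendre corner are two convergent one-dimensional identities of value
`log 4` inside the Kontsevich–Zagier calculus:

* (i) `[(0,1), ((1−s)^{−1/2} − 1)/s] ∼ [(1,4), 1/v]`;
* (ii) `[(0,∞), (σ(1+σ))^{−1/2} − 1/(1+σ)] ∼ [(1,4), 1/v]`.

Proof: three honest pull-backs along rational charts of `ℝ¹` (Kontsevich–Zagier rule (2), packaged with
integrability of the pulled-back record by `InverseLandau.tateLifting_pullback_dimOne`), all landing on
the common representation `[(0,1), 2/(1+u)]`:

* the chart `v = (1+u)²` pulls `[(1,4), 1/v]` back to `[(0,1), 2(1+u)/(1+u)²] = [(0,1), 2/(1+u)]`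
  (`LegendreCornerStrata.core`);
* the chart `s = 1 − u²` (i.e. `u = √(1−s)`) pulls the stratum (i) back to
  `[(0,1), 2u·((u²)^{−1/2} − 1)/(1 − u²)] = [(0,1), 2/(1+u)]` (`LegendreCornerStrata.stratum_one`);
* the chart `σ = (1−s)/s` pulls the stratum (ii) back to the stratum (i):
  `(1/s²)·(s(1−s)^{−1/2} − s) = ((1−s)^{−1/2} − 1)/s` (`LegendreCornerStrata.stratum_two`).

Representations with the same domain and integrands agreeing on it are equivalent
(`KZ.of_sub_of_mem_relations_of_eqOn`), which absorbs the `Set.EqOn` pinning of the given data.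
One-dimensional bookkeeping (`image_lift`, `KZ.BallPeeling.isSemialgebraic_posIoo`) is reused from the
tree.

References: M. Kontsevich, D. Zagier, *Periods* (2001), §1.2 rule (2); C. Dupont, E. Panzer, B. Pym,
*Logarithmic morphisms, tangential basepoints, and little disks* (regularised limits at a corner);
E. T. Whittaker, G. N. Watson, *A Course of Modern Analysis* (1927), §22.737 (`K′ ∼ log(4/k)`).
-/

noncomputable section

open MeasureTheory Set
open Literature.NumberTheory.Transcendental
open Literature.ModelTheory.ExponentialFields (IsSemialgebraic)
open Summit.KontsevichZagierPeriods.InverseLandau (tateLifting_pullback_dimOne)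
open Summit.KontsevichZagierPeriods.HeckeMultiplicityOne.TorsionTiling11a1 (image_lift)
open KZ.BallPeeling (isSemialgebraic_posIoo)

namespace Summit.KontsevichZagierPeriods.GammaCornerAnomaly

namespace LegendreCornerStrata

/-! ## Scalar charts read on `ℝ¹ = Fin 1 → ℝ` -/

/-- A scalar map injective on `S ⊆ ℝ` is injective on `{y | y 0 ∈ S} ⊆ ℝ¹` when read on the
coordinate. [folklore] -/
theorem injOn_fin_one {φ : ℝ → ℝ} {S : Set ℝ} (h : InjOn φ S) :
    InjOn (fun y : Fin 1 → ℝ => fun _ : Fin 1 => φ (y 0)) {y | y 0 ∈ S} := by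
  intro a ha b hb hab
  have h0 : a 0 = b 0 := h ha hb (congrFun hab 0)
  funext i
  rw [Fin.fin_one_eq_zero i]
  exact h0

/-- A `ℚ`-polynomial in the coordinate is a `ℚ`-semialgebraic function on `(0,1) ⊆ ℝ¹`.
[cite: BCR1998, §2.2] -/
theorem isSemialgebraicFunOn_unit_aeval (p : MvPolynomial (Fin 1) ℚ) {f : (Fin 1 → ℝ) → ℝ}
    (hf : ∀ y, f y = MvPolynomial.aeval y p) :
    IsSemialgebraicFunOn ℚ {y : Fin 1 → ℝ | y 0 ∈ Set.Ioo (0:ℝ) 1} f :=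
  (isSemialgebraicFunOn_aeval isSemialgebraic_posIoo p).congr fun y _ => (hf y).symm

/-- A quotient of `ℚ`-polynomials in the coordinate by a power of the coordinate is a
`ℚ`-semialgebraic function on `(0,1) ⊆ ℝ¹`. [cite: BCR1998, §2.2] -/
theorem isSemialgebraicFunOn_unit_div_pow (p : MvPolynomial (Fin 1) ℚ) (k : ℕ)
    {f : (Fin 1 → ℝ) → ℝ} (hf : ∀ y, f y = MvPolynomial.aeval y p / (y 0) ^ k) :
    IsSemialgebraicFunOn ℚ {y : Fin 1 → ℝ | y 0 ∈ Set.Ioo (0:ℝ) 1} f := by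
  refine (isSemialgebraicFunOn_aeval_div_aeval isSemialgebraic_posIoo p (MvPolynomial.X 0 ^ k)
    fun y hy => ?_).congr fun y _ => ?_
  · have hy' : (0:ℝ) < y 0 := hy.1
    simpa using (pow_pos hy' k).ne'
  · rw [hf y]
    simp

/-! ## The chart `v = (1+u)²` of `(1,4)` by `(0,1)` -/

/-- `u ↦ (1+u)²` is injective on `(0,1)`. [folklore] -/
theorem injOn_sq_one_add : InjOn (fun u : ℝ => (1 + u) ^ 2) (Set.Ioo (0:ℝ) 1) := by
  intro a ha b hb hab
  have h : 1 + a = 1 + b :=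
    (pow_left_inj₀ (by linarith [ha.1]) (by linarith [hb.1]) two_ne_zero).1 hab
  linarith

/-- `u ↦ (1+u)²` maps `(0,1)` onto `(1,4)` (inverse `u = √v − 1`). [folklore] -/
theorem image_sq_one_add : (fun u : ℝ => (1 + u) ^ 2) '' Set.Ioo (0:ℝ) 1 = Set.Ioo (1:ℝ) 4 := by
  ext v
  constructor
  · rintro ⟨u, hu, rfl⟩
    constructor <;> nlinarith [hu.1, hu.2]
  · rintro ⟨hv1, hv4⟩
    have hv0 : (0:ℝ) ≤ v := by linarith
    have hs1 : 1 < Real.sqrt v := Real.lt_sqrt_of_sq_lt (by nlinarith)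
    have hs2 : Real.sqrt v < 2 := (Real.sqrt_lt' two_pos).2 (by nlinarith)
    refine ⟨Real.sqrt v - 1, ⟨by linarith, by linarith⟩, ?_⟩
    show (1 + (Real.sqrt v - 1)) ^ 2 = v
    rw [add_sub_cancel, Real.sq_sqrt hv0]

/-- **The core identity `[(0,1), 2/(1+u)] ∼ [(1,4), 1/v]`**: ONE change of variables `v = (1+u)²`
(`dv/v = 2 du/(1+u)`), as the honest pull-back of the given target along the chart followed by
equality of integrands on the common domain `(0,1)`. [cite: KontsevichZagier2001, §1.2 rule (2)] -/
theorem core (R r' : KZ.IntegralRep 1) (hRd : R.domain = {q | q 0 ∈ Set.Ioo (0:ℝ) 1})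
    (hRi : Set.EqOn R.integrand (fun q => 2 / (1 + q 0)) R.domain)
    (hr'd : r'.domain = {q | q 0 ∈ Set.Ioo (1:ℝ) 4})
    (hr'i : Set.EqOn r'.integrand (fun q => 1 / q 0) r'.domain) : KZ.Equivalent R r' := by
  -- pull `r'` back along `v = (1+u)²` on `D = (0,1)`, Jacobian `2(1+u)`
  have hφ : IsSemialgebraicFunOn ℚ {y : Fin 1 → ℝ | y 0 ∈ Set.Ioo (0:ℝ) 1}
      (fun y => (fun u : ℝ => (1 + u) ^ 2) (y 0)) :=
    isSemialgebraicFunOn_unit_aeval ((1 + MvPolynomial.X 0) ^ 2) fun y => by simp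
  have hJ : IsSemialgebraicFunOn ℚ {y : Fin 1 → ℝ | y 0 ∈ Set.Ioo (0:ℝ) 1}
      (fun y => 2 * (1 + y 0)) :=
    isSemialgebraicFunOn_unit_aeval (MvPolynomial.C 2 * (1 + MvPolynomial.X 0)) fun y => by simp
  have hder : ∀ y ∈ {y : Fin 1 → ℝ | y 0 ∈ Set.Ioo (0:ℝ) 1},
      HasDerivAt (fun u : ℝ => (1 + u) ^ 2) ((fun u : ℝ => 2 * (1 + u)) (y 0)) (y 0) := by
    intro y _
    exact (((hasDerivAt_id' (y 0)).const_add 1).fun_pow 2).congr_deriv (by norm_num)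
  have himg : (fun y : Fin 1 → ℝ => fun _ : Fin 1 => (fun u : ℝ => (1 + u) ^ 2) (y 0)) ''
      {y : Fin 1 → ℝ | y 0 ∈ Set.Ioo (0:ℝ) 1} = r'.domain := by
    rw [hr'd, image_lift (fun u : ℝ => (1 + u) ^ 2) (Set.Ioo (0:ℝ) 1), image_sq_one_add]
  have hJdet : ∀ y ∈ {y : Fin 1 → ℝ | y 0 ∈ Set.Ioo (0:ℝ) 1},
      (fun y : Fin 1 → ℝ => 2 * (1 + y 0)) y = |(fun u : ℝ => 2 * (1 + u)) (y 0)| := by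
    intro y hy
    have hy' : (0:ℝ) < y 0 := hy.1
    exact (abs_of_pos (by positivity)).symm
  obtain ⟨P, hPd, hPi, hrel⟩ := tateLifting_pullback_dimOne r' {y : Fin 1 → ℝ | y 0 ∈ Set.Ioo (0:ℝ) 1}
    (fun u : ℝ => (1 + u) ^ 2) (fun u : ℝ => 2 * (1 + u)) (fun y => 2 * (1 + y 0))
    isSemialgebraic_posIoo hφ hder (injOn_fin_one injOn_sq_one_add) himg hJ hJdet
  have h₁ : KZ.Equivalent r' P := hrel
  -- `R` and `P` have the same domain and the same integrand `2/(1+u)` on it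
  have h₂ : KZ.Equivalent R P := by
    refine KZ.of_sub_of_mem_relations_of_eqOn (by rw [hPd, hRd]) fun y hy => ?_
    have hy' : y 0 ∈ Set.Ioo (0:ℝ) 1 := by rw [hRd] at hy; exact hy
    have hv : (fun _ : Fin 1 => (fun u : ℝ => (1 + u) ^ 2) (y 0)) ∈ r'.domain := by
      rw [← himg]
      exact mem_image_of_mem _ hy'
    rw [hRi hy, hPi]
    show 2 / (1 + y 0) = 2 * (1 + y 0) * r'.integrand (fun _ : Fin 1 => (1 + y 0) ^ 2)
    rw [hr'i hv]
    have h1 : (0:ℝ) < 1 + y 0 := by linarith [hy'.1]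
    field_simp
  exact h₂.trans h₁.symm

/-! ## Stratum (i): the chart `s = 1 − u²` -/

/-- `u ↦ 1 − u²` is injective on `(0,1)`. [folklore] -/
theorem injOn_one_sub_sq : InjOn (fun u : ℝ => 1 - u ^ 2) (Set.Ioo (0:ℝ) 1) := by
  intro a ha b hb hab
  have h : a ^ 2 = b ^ 2 := by
    have hab' : 1 - a ^ 2 = 1 - b ^ 2 := hab
    linarith
  exact (pow_left_inj₀ ha.1.le hb.1.le two_ne_zero).1 h

/-- `u ↦ 1 − u²` maps `(0,1)` onto `(0,1)` (inverse `u = √(1−s)`). [folklore] -/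
theorem image_one_sub_sq : (fun u : ℝ => 1 - u ^ 2) '' Set.Ioo (0:ℝ) 1 = Set.Ioo (0:ℝ) 1 := by
  ext s
  constructor
  · rintro ⟨u, hu, rfl⟩
    constructor <;> nlinarith [hu.1, hu.2]
  · rintro ⟨hs0, hs1⟩
    have h1s : (0:ℝ) < 1 - s := by linarith
    have hr0 : 0 < Real.sqrt (1 - s) := Real.sqrt_pos.2 h1s
    have hr1 : Real.sqrt (1 - s) < 1 := (Real.sqrt_lt' one_pos).2 (by nlinarith)
    refine ⟨Real.sqrt (1 - s), ⟨hr0, hr1⟩, ?_⟩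
    show 1 - Real.sqrt (1 - s) ^ 2 = s
    rw [Real.sq_sqrt h1s.le]
    ring

/-- The Jacobian identity of the chart `s = 1 − u²`: for `0 < u < 1`,
`2u · ((1 − (1 − u²))^{−1/2} − 1)/(1 − u²) = 2/(1+u)`. [folklore] -/
theorem jacobian_one_sub_sq {u : ℝ} (hu : 0 < u) (hu1 : u < 1) :
    2 * u * (((1 - (1 - u ^ 2)) ^ (-(1:ℝ) / 2) - 1) / (1 - u ^ 2)) = 2 / (1 + u) := by
  have e1 : (1:ℝ) - (1 - u ^ 2) = u ^ 2 := by ring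
  have e2 : (u ^ 2) ^ (-(1:ℝ) / 2) = u⁻¹ := by
    rw [← Real.rpow_two, ← Real.rpow_mul hu.le]
    norm_num [Real.rpow_neg_one]
  rw [e1, e2]
  have h1 : (1:ℝ) - u ^ 2 ≠ 0 := by nlinarith
  have h2 : (0:ℝ) < 1 + u := by linarith
  field_simp
  ring

/-- **Stratum (i)**: `[(0,1), ((1−s)^{−1/2} − 1)/s] ∼ [(1,4), 1/v]`, by the pull-back along
`s = 1 − u²` onto `[(0,1), 2/(1+u)]` and `core`. [cite: KontsevichZagier2001, §1.2 rule (2)] -/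
theorem stratum_one (r r' : KZ.IntegralRep 1) (hrd : r.domain = {q | q 0 ∈ Set.Ioo (0:ℝ) 1})
    (hri : Set.EqOn r.integrand (fun q => ((1 - q 0) ^ (-(1:ℝ) / 2) - 1) / q 0) r.domain)
    (hr'd : r'.domain = {q | q 0 ∈ Set.Ioo (1:ℝ) 4})
    (hr'i : Set.EqOn r'.integrand (fun q => 1 / q 0) r'.domain) : KZ.Equivalent r r' := by
  -- pull `r` back along `s = 1 − u²` on `D = (0,1)`, Jacobian `|−2u| = 2u`
  have hφ : IsSemialgebraicFunOn ℚ {y : Fin 1 → ℝ | y 0 ∈ Set.Ioo (0:ℝ) 1}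
      (fun y => (fun u : ℝ => 1 - u ^ 2) (y 0)) :=
    isSemialgebraicFunOn_unit_aeval (1 - MvPolynomial.X 0 ^ 2) fun y => by simp
  have hJ : IsSemialgebraicFunOn ℚ {y : Fin 1 → ℝ | y 0 ∈ Set.Ioo (0:ℝ) 1}
      (fun y => 2 * y 0) :=
    isSemialgebraicFunOn_unit_aeval (MvPolynomial.C 2 * MvPolynomial.X 0) fun y => by simp
  have hder : ∀ y ∈ {y : Fin 1 → ℝ | y 0 ∈ Set.Ioo (0:ℝ) 1},
      HasDerivAt (fun u : ℝ => 1 - u ^ 2) ((fun u : ℝ => -(2 * u)) (y 0)) (y 0) := by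
    intro y _
    exact ((hasDerivAt_pow 2 (y 0)).const_sub 1).congr_deriv (by norm_num)
  have himg : (fun y : Fin 1 → ℝ => fun _ : Fin 1 => (fun u : ℝ => 1 - u ^ 2) (y 0)) ''
      {y : Fin 1 → ℝ | y 0 ∈ Set.Ioo (0:ℝ) 1} = r.domain := by
    rw [hrd, image_lift (fun u : ℝ => 1 - u ^ 2) (Set.Ioo (0:ℝ) 1), image_one_sub_sq]
  have hJdet : ∀ y ∈ {y : Fin 1 → ℝ | y 0 ∈ Set.Ioo (0:ℝ) 1},
      (fun y : Fin 1 → ℝ => 2 * y 0) y = |(fun u : ℝ => -(2 * u)) (y 0)| := by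
    intro y hy
    have hy' : (0:ℝ) < y 0 := hy.1
    show 2 * y 0 = |-(2 * y 0)|
    rw [abs_neg, abs_of_pos (by positivity)]
  obtain ⟨P, hPd, hPi, hrel⟩ := tateLifting_pullback_dimOne r {y : Fin 1 → ℝ | y 0 ∈ Set.Ioo (0:ℝ) 1}
    (fun u : ℝ => 1 - u ^ 2) (fun u : ℝ => -(2 * u)) (fun y => 2 * y 0)
    isSemialgebraic_posIoo hφ hder (injOn_fin_one injOn_one_sub_sq) himg hJ hJdet
  have h₁ : KZ.Equivalent r P := hrel
  -- the pulled-back integrand is `2/(1+u)` on `(0,1)`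
  have hPi' : Set.EqOn P.integrand (fun q => 2 / (1 + q 0)) P.domain := by
    intro y hy
    have hy' : y 0 ∈ Set.Ioo (0:ℝ) 1 := by rw [hPd] at hy; exact hy
    have hv : (fun _ : Fin 1 => (fun u : ℝ => 1 - u ^ 2) (y 0)) ∈ r.domain := by
      rw [← himg]
      exact mem_image_of_mem _ hy'
    rw [hPi]
    show 2 * y 0 * r.integrand (fun _ : Fin 1 => 1 - (y 0) ^ 2) = 2 / (1 + y 0)
    rw [hri hv]
    exact jacobian_one_sub_sq hy'.1 hy'.2
  exact h₁.trans (core P r' hPd hPi' hr'd hr'i)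

/-! ## Stratum (ii): the chart `σ = (1−s)/s` -/

/-- `s ↦ (1−s)/s` is injective on `(0,1)`. [folklore] -/
theorem injOn_moebius : InjOn (fun s : ℝ => (1 - s) / s) (Set.Ioo (0:ℝ) 1) := by
  intro a ha b hb hab
  have hab' : (1 - a) / a = (1 - b) / b := hab
  rw [div_eq_div_iff ha.1.ne' hb.1.ne'] at hab'
  linarith

/-- `s ↦ (1−s)/s` maps `(0,1)` onto `(0,∞)` (inverse `s = 1/(1+σ)`). [folklore] -/
theorem image_moebius : (fun s : ℝ => (1 - s) / s) '' Set.Ioo (0:ℝ) 1 = Set.Ioi (0:ℝ) := by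
  ext σ
  constructor
  · rintro ⟨s, hs, rfl⟩
    exact div_pos (by linarith [hs.2]) hs.1
  · intro hσ
    have hσ' : (0:ℝ) < σ := hσ
    have h1 : (0:ℝ) < 1 + σ := by linarith
    refine ⟨1 / (1 + σ), ⟨by positivity, (div_lt_one h1).2 (by linarith)⟩, ?_⟩
    show (1 - 1 / (1 + σ)) / (1 / (1 + σ)) = σ
    field_simp
    ring

/-- The Jacobian identity of the chart `σ = (1−s)/s`: for `0 < s < 1`,
`(1/s²)·((σ(1+σ))^{−1/2} − 1/(1+σ)) = ((1−s)^{−1/2} − 1)/s` at `σ = (1−s)/s`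
(`σ(1+σ) = (1−s)/s²`, `1/(1+σ) = s`). [folklore] -/
theorem jacobian_moebius {s : ℝ} (hs : 0 < s) (hs1 : s < 1) :
    1 / s ^ 2 * (((1 - s) / s * (1 + (1 - s) / s)) ^ (-(1:ℝ) / 2) - 1 / (1 + (1 - s) / s)) =
      ((1 - s) ^ (-(1:ℝ) / 2) - 1) / s := by
  have h1s : (0:ℝ) < 1 - s := by linarith
  have e1 : (1 - s) / s * (1 + (1 - s) / s) = (1 - s) / s ^ 2 := by
    field_simp
    ring
  have e2 : ((1 - s) / s ^ 2) ^ (-(1:ℝ) / 2) = (1 - s) ^ (-(1:ℝ) / 2) * s := by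
    rw [Real.div_rpow h1s.le (sq_nonneg s), ← Real.rpow_two, ← Real.rpow_mul hs.le]
    norm_num [Real.rpow_neg_one]
  have e3 : 1 / (1 + (1 - s) / s) = s := by
    field_simp
    ring
  rw [e1, e2, e3]
  field_simp

/-- **Stratum (ii)**: `[(0,∞), (σ(1+σ))^{−1/2} − 1/(1+σ)] ∼ [(1,4), 1/v]`, by the pull-back along
`σ = (1−s)/s` onto the stratum (i) and `stratum_one`. [cite: KontsevichZagier2001, §1.2 rule (2)] -/
theorem stratum_two (r r' : KZ.IntegralRep 1) (hrd : r.domain = {q | 0 < q 0})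
    (hri : Set.EqOn r.integrand (fun q => (q 0 * (1 + q 0)) ^ (-(1:ℝ) / 2) - 1 / (1 + q 0))
      r.domain)
    (hr'd : r'.domain = {q | q 0 ∈ Set.Ioo (1:ℝ) 4})
    (hr'i : Set.EqOn r'.integrand (fun q => 1 / q 0) r'.domain) : KZ.Equivalent r r' := by
  -- pull `r` back along `σ = (1−s)/s` on `D = (0,1)`, Jacobian `|−1/s²| = 1/s²`
  have hφ : IsSemialgebraicFunOn ℚ {y : Fin 1 → ℝ | y 0 ∈ Set.Ioo (0:ℝ) 1}
      (fun y => (fun s : ℝ => (1 - s) / s) (y 0)) :=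
    isSemialgebraicFunOn_unit_div_pow (1 - MvPolynomial.X 0) 1 fun y => by simp
  have hJ : IsSemialgebraicFunOn ℚ {y : Fin 1 → ℝ | y 0 ∈ Set.Ioo (0:ℝ) 1}
      (fun y => 1 / (y 0) ^ 2) :=
    isSemialgebraicFunOn_unit_div_pow 1 2 fun y => by simp
  have hder : ∀ y ∈ {y : Fin 1 → ℝ | y 0 ∈ Set.Ioo (0:ℝ) 1},
      HasDerivAt (fun s : ℝ => (1 - s) / s) ((fun s : ℝ => -(1 / s ^ 2)) (y 0)) (y 0) := by
    intro y hy
    have hy' : (y 0) ≠ 0 := hy.1.ne'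
    exact (((hasDerivAt_id' (y 0)).const_sub 1).fun_div (hasDerivAt_id' (y 0)) hy').congr_deriv
      (by ring)
  have himg : (fun y : Fin 1 → ℝ => fun _ : Fin 1 => (fun s : ℝ => (1 - s) / s) (y 0)) ''
      {y : Fin 1 → ℝ | y 0 ∈ Set.Ioo (0:ℝ) 1} = r.domain := by
    rw [hrd, image_lift (fun s : ℝ => (1 - s) / s) (Set.Ioo (0:ℝ) 1), image_moebius]
    rfl
  have hJdet : ∀ y ∈ {y : Fin 1 → ℝ | y 0 ∈ Set.Ioo (0:ℝ) 1},
      (fun y : Fin 1 → ℝ => 1 / (y 0) ^ 2) y = |(fun s : ℝ => -(1 / s ^ 2)) (y 0)| := by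
    intro y hy
    have hy' : (0:ℝ) < y 0 := hy.1
    show 1 / (y 0) ^ 2 = |-(1 / (y 0) ^ 2)|
    rw [abs_neg, abs_of_pos (by positivity)]
  obtain ⟨P, hPd, hPi, hrel⟩ := tateLifting_pullback_dimOne r {y : Fin 1 → ℝ | y 0 ∈ Set.Ioo (0:ℝ) 1}
    (fun s : ℝ => (1 - s) / s) (fun s : ℝ => -(1 / s ^ 2)) (fun y => 1 / (y 0) ^ 2)
    isSemialgebraic_posIoo hφ hder (injOn_fin_one injOn_moebius) himg hJ hJdet
  have h₁ : KZ.Equivalent r P := hrel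
  -- the pulled-back integrand is the stratum (i) integrand on `(0,1)`
  have hPi' : Set.EqOn P.integrand (fun q => ((1 - q 0) ^ (-(1:ℝ) / 2) - 1) / q 0) P.domain := by
    intro y hy
    have hy' : y 0 ∈ Set.Ioo (0:ℝ) 1 := by rw [hPd] at hy; exact hy
    have hv : (fun _ : Fin 1 => (fun s : ℝ => (1 - s) / s) (y 0)) ∈ r.domain := by
      rw [← himg]
      exact mem_image_of_mem _ hy'
    rw [hPi]
    show 1 / (y 0) ^ 2 * r.integrand (fun _ : Fin 1 => (1 - y 0) / y 0) =
      ((1 - y 0) ^ (-(1:ℝ) / 2) - 1) / y 0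
    rw [hri hv]
    exact jacobian_moebius hy'.1 hy'.2
  exact h₁.trans (stratum_one P r' hPd hPi' hr'd hr'i)

end LegendreCornerStrata

/-- **`LegendreCornerStrata`** (route GammaCornerAnomaly, stmt-KontsevichZagierPeriods-8980): the two
strata of the blown-up Legendre corner, (i) `[(0,1), ((1−s)^{−1/2} − 1)/s] ∼ [(1,4), 1/v]` and
(ii) `[(0,∞), (σ(1+σ))^{−1/2} − 1/(1+σ)] ∼ [(1,4), 1/v]` (both of value `log 4`), hold inside the
Kontsevich–Zagier calculus: the rational charts `s = 1 − u²`, `σ = (1−s)/s` and `v = (1+u)²` of `ℝ¹`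
(rule (2), honest pull-backs) carry both sides onto `[(0,1), 2/(1+u)]`. [folklore] -/
theorem legendreCornerStrata_proof :
    Summit.KontsevichZagierPeriods.KontsevichZagierPeriods.Theses.GammaCornerAnomaly.LegendreCornerStrata :=
  ⟨LegendreCornerStrata.stratum_one, LegendreCornerStrata.stratum_two⟩

end Summit.KontsevichZagierPeriods.GammaCornerAnomaly

end
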